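import Mathlib
import HarnessLib
import Summits.NavierStokesRegularity.NavierStokesRegularity.Theorems.TaylorModelRungThreeCertificateSoundStep
import Summits.NavierStokesRegularity.NavierStokesRegularity.Theorems.TaylorModelRungThreeCertificateReadoutsSound

/-!
# Crux K1b-DR (stmt-NavierStokesRegularity-23954), line `taylor-model` — certificate SOUNDNESS for the `Readouts`
# block, part 2: the surrogates and the enclosure of the crossing states

From `checkReadoutAux = true`: the real inequalities `φ pθ ≤ 2^(-θ)`, `φ r34 ≤ 2^(3(Kb+1)/4)`,
`√(10·Cg·2^(-7(Ka+1))) ≤ φ tv` (rpow algebra). For the crossing states `y = TP u + w'` (`u ∈ [0,h]`, `w' ∈ Ball(sp)`)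
of a sub-step: the coordinate enclosures `|y_c − P0_c| ≤ tpRad_c + sp·ω_c`, hence `yLo ≤ y_c ≤ yHi`, `|y_c| ≤ yAbs_c`,
`aLo ≤ |y_{i₀,1}|` (window values of `TP` from `…CertificateSoundStep`, `wv_TP`); the interval-quotient lemma
`quot_mem`; window bookkeeping for the shells `-Kb`, `k+1`.

MODEL-lattice rung TL-M3 only; nothing here is a statement about the Navier–Stokes equations.
-/

-- the sub-problem namespace repeats the summit name by design (D-0017)
set_option linter.dupNamespace false

namespace Summit.NavierStokesRegularity.NavierStokesRegularity.Theorems.TaylorModelCert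

open scoped BigOperators
open Literature.Analysis.FluidPDE.TaoCascade Literature.Analysis.FluidPDE.TaoCascade.TaylorChain

/-! ### The interval quotient -/

section RealFacts

/-- Interval quotient: `Y ∈ [L, U]`, `D ∈ [a, A]`, `0 < a` ⟹ `Y/D ∈ [min (L/a) (L/A), max (U/a) (U/A)]`. [folklore] -/
theorem quot_mem {L U a A Y D : ℝ} (hY : L ≤ Y ∧ Y ≤ U) (ha : 0 < a) (hD : a ≤ D ∧ D ≤ A) :
    min (L / a) (L / A) ≤ Y / D ∧ Y / D ≤ max (U / a) (U / A) := by
  have hDp : 0 < D := lt_of_lt_of_le ha hD.1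
  have hAp : 0 < A := lt_of_lt_of_le hDp hD.2
  rcases le_or_gt 0 Y with hy | hy
  · constructor
    · refine (min_le_right _ _).trans ?_
      exact (div_le_div_of_nonneg_right hY.1 hAp.le).trans (div_le_div_of_nonneg_left hy hDp hD.2)
    · refine le_trans ?_ (le_max_left _ _)
      exact (div_le_div_of_nonneg_left hy ha hD.1).trans (div_le_div_of_nonneg_right hY.2 ha.le)
  · constructor
    · refine (min_le_left _ _).trans ?_
      refine (div_le_div_of_nonneg_right hY.1 ha.le).trans ?_
      rw [div_le_div_iff₀ ha hDp]
      nlinarith [hD.1]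
    · refine le_trans ?_ (le_max_right _ _)
      refine le_trans ?_ (div_le_div_of_nonneg_right hY.2 hAp.le)
      rw [div_le_div_iff₀ hDp hAp]
      nlinarith [hD.2]

end RealFacts

namespace CertTables

/-! ### The surrogates -/

section Aux

variable {K : Type} [Field K] [LinearOrder K] {φ : K →+* ℝ} (hφ : Monotone φ) (T : CertTables K)
  (A : ReadoutAux K)
include hφ

/-- What `checkReadoutAux` certifies, as real statements. [folklore] -/
theorem aux_sound (h : T.checkReadoutAux A = true) :
    0 ≤ T.Kb ∧ 1 ≤ T.Ka ∧ 0 ≤ φ T.Cb ∧ 0 ≤ φ A.pθ ∧ φ A.pθ ≤ (2:ℝ) ^ (-(φ T.θ)) ∧ 0 ≤ φ A.r34 ∧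
      φ A.r34 ≤ (2:ℝ) ^ ((3:ℝ) / 4 * ((T.Kb:ℝ) + 1)) ∧
      Real.sqrt (10 * φ T.Cg * (2:ℝ) ^ (-(7:ℝ) * ((T.Ka:ℝ) + 1))) ≤ φ A.tv := by
  simp only [checkReadoutAux, Bool.and_eq_true, decide_eq_true_eq] at h
  obtain ⟨⟨⟨⟨⟨⟨⟨⟨⟨⟨hKb, hKa⟩, hCb⟩, hden⟩, hθ⟩, hp0⟩, hp⟩, hr0⟩, hr⟩, ht0⟩, ht⟩ := h
  have two : φ 2 = 2 := map_ofNat φ 2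
  -- `x ≥ 0`, `x^n ≤ y`, `n ≠ 0` ⟹ `x ≤ y^(1/n)`
  have root : ∀ {x y : ℝ} {n : ℕ}, 0 ≤ x → n ≠ 0 → x ^ n ≤ y → x ≤ y ^ ((n : ℝ)⁻¹) := by
    intro x y n hx hn h
    have := Real.rpow_le_rpow (pow_nonneg hx n) h (inv_nonneg.2 (Nat.cast_nonneg n))
    rwa [Real.pow_rpow_inv_natCast hx hn] at this
  refine ⟨hKb, hKa, phi_nonneg hφ hCb, phi_nonneg hφ hp0, ?_, phi_nonneg hφ hr0, ?_, ?_⟩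
  · -- pθ ≤ 2^(-θ)
    have hθr : φ T.θ = (A.θnum : ℝ) / (A.θden : ℝ) := by
      have e := congrArg φ hθ
      rw [map_mul, map_natCast, map_natCast] at e
      rw [eq_div_iff (by exact_mod_cast hden.ne')]
      exact e
    have hx0 : 0 ≤ φ A.pθ := phi_nonneg hφ hp0
    have h1 : φ A.pθ ^ A.θden * (2:ℝ) ^ A.θnum ≤ 1 := by
      have := hφ hp
      simpa [map_mul, map_pow, two] using this
    have h2 : φ A.pθ ^ A.θden ≤ (2:ℝ) ^ (-(A.θnum : ℝ)) := by
      rw [Real.rpow_neg (by norm_num), Real.rpow_natCast, ← one_div, le_div_iff₀ (by positivity)]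
      exact h1
    have h3 := root hx0 hden.ne' h2
    rw [← Real.rpow_mul (by norm_num)] at h3
    rw [hθr]
    convert h3 using 2
    field_simp
  · -- r34 ≤ 2^(3(Kb+1)/4)
    have hx0 : 0 ≤ φ A.r34 := phi_nonneg hφ hr0
    have h1 : φ A.r34 ^ 4 ≤ (2:ℝ) ^ (3 * (T.Kb + 1).toNat) := by
      have := hφ hr
      simpa [map_pow, two] using this
    have h3 := root hx0 (by norm_num : (4:ℕ) ≠ 0) h1
    rw [← Real.rpow_natCast, ← Real.rpow_mul (by norm_num)] at h3
    have e : (((T.Kb + 1).toNat : ℕ) : ℝ) = (T.Kb : ℝ) + 1 := by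
      have := Int.toNat_of_nonneg (show 0 ≤ T.Kb + 1 by omega)
      exact_mod_cast this
    convert h3 using 2
    push_cast
    rw [e]
    ring
  · -- tail half-width
    have hx0 : 0 ≤ φ A.tv := phi_nonneg hφ ht0
    have h1 : 10 * φ T.Cg ≤ φ A.tv ^ 2 * (2:ℝ) ^ (7 * (T.Ka + 1).toNat) := by
      have := hφ ht
      simpa [map_mul, map_pow, two, map_ofNat] using this
    have e : (((T.Ka + 1).toNat : ℕ) : ℝ) = (T.Ka : ℝ) + 1 := by
      have := Int.toNat_of_nonneg (show 0 ≤ T.Ka + 1 by omega)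
      exact_mod_cast this
    have e2 : (2:ℝ) ^ (-(7:ℝ) * ((T.Ka:ℝ) + 1)) = ((2:ℝ) ^ (7 * (T.Ka + 1).toNat))⁻¹ := by
      rw [← Real.rpow_natCast, ← Real.rpow_neg (by norm_num)]
      congr 1
      push_cast
      rw [e]
      ring
    have hpos : 0 < (2:ℝ) ^ (7 * (T.Ka + 1).toNat) := by positivity
    have h2 : 10 * φ T.Cg * (2:ℝ) ^ (-(7:ℝ) * ((T.Ka:ℝ) + 1)) ≤ φ A.tv ^ 2 := by
      rw [e2, ← div_eq_mul_inv, div_le_iff₀ hpos]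
      exact h1
    calc Real.sqrt (10 * φ T.Cg * (2:ℝ) ^ (-(7:ℝ) * ((T.Ka:ℝ) + 1)))
        ≤ Real.sqrt (φ A.tv ^ 2) := Real.sqrt_le_sqrt h2
      _ = φ A.tv := Real.sqrt_sq hx0

end Aux

/-! ### Window bookkeeping for the shells `1`, `-Kb`, `k + 1` -/

section WindowFacts

variable {K : Type} (T : CertTables K)

/-- `idx i (-Kb) = i·m`. [folklore] -/
theorem idx_negKb (i : Fin 4) : T.idx i (-T.Kb) = i.val * T.m := by
  unfold idx; simp

/-- One shell up stays in the same mode block: `idx i (k + 1) = idx i k + 1` on the window. [folklore] -/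
theorem idx_succ (i : Fin 4) {k : ℤ} (hk : -T.Kb ≤ k) : T.idx i (k + 1) = T.idx i k + 1 := by
  unfold idx
  have : (k + 1 + T.Kb).toNat = (k + T.Kb).toNat + 1 := by omega
  rw [this]; ring

/-- `upInW c` decides `wk c + 1 ≤ Ka` for a window coordinate `c`. [folklore] -/
theorem upInW_iff (c : ℕ) (hW : -T.Kb ≤ (1:ℤ) ∧ (1:ℤ) ≤ T.Ka) :
    T.upInW c = true ↔ T.wk c + 1 ≤ T.Ka := by
  have hm := T.m_eq_of_InW hW
  unfold upInW wk
  rw [decide_eq_true_eq]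
  omega

end WindowFacts

/-! ### Enclosure of the crossing states `y = TP u + w'` -/

section Enclosure

variable {K : Type} [Field K] [LinearOrder K] {φ : K →+* ℝ} (hφ : Monotone φ) (T : CertTables K)
include hφ

/-- `φ (tpRad) = Σ_{q<pdeg} |φ P_{q+1,c}| (φ h)^(q+1)`. [folklore] -/
theorem phi_tpRad (N : NodeTables K) (h : K) (c : ℕ) :
    φ (T.tpRad N h c) = ∑ q ∈ Finset.range T.pdeg, |φ (vget (N.P.getD (q + 1) []) c)| * φ h ^ (q + 1) := by
  unfold tpRad
  rw [phi_sumN]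
  refine Finset.sum_congr rfl fun q _ => by rw [map_mul, phi_abs hφ, map_pow]

/-- The basic enclosure: `|y_c − φ P0_c| ≤ φ (tpRad_c + sp·ω_c)` for `y = TP u + w'`, `u ∈ [0, φ h]`,
`w' ∈ Ball(φ sp)`. [folklore] -/
theorem abs_wv_sub_tp0_le (j s : ℕ) (h sp : K) {u : ℝ} (hu : u ∈ Set.Icc 0 (φ h))
    {w' : Fin 4 → ℤ → ℝ} (hw : (T.toCertData φ).InBall j w' (φ sp)) {c : ℕ} (hc : c < T.n) :
    |T.wv ((T.toCertData φ).TP j s u + w') c - φ (tp0 (T.node j s) c)| ≤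
      φ (T.tpRad (T.node j s) h c + sp * T.wgt j c) := by
  rw [T.inBall_iff φ] at hw
  have hwc := hw c hc
  have e : T.wv ((T.toCertData φ).TP j s u + w') c = T.wv ((T.toCertData φ).TP j s u) c + T.wv w' c := rfl
  rw [e, T.wv_TP φ j s u hc, Finset.sum_range_succ', pow_zero, mul_one, tp0, map_add, map_mul, T.phi_tpRad hφ]
  have e2 : ∑ q ∈ Finset.range T.pdeg, φ (vget ((T.node j s).P.getD (q + 1) []) c) * u ^ (q + 1) +
      φ (vget ((T.node j s).P.getD 0 []) c) + T.wv w' c - φ (vget ((T.node j s).P.getD 0 []) c) =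
      ∑ q ∈ Finset.range T.pdeg, φ (vget ((T.node j s).P.getD (q + 1) []) c) * u ^ (q + 1) + T.wv w' c := by ring
  rw [e2]
  refine (abs_add_le _ _).trans (add_le_add ?_ hwc)
  refine (Finset.abs_sum_le_sum_abs _ _).trans (Finset.sum_le_sum fun q _ => ?_)
  rw [abs_mul, abs_pow]
  refine mul_le_mul_of_nonneg_left ?_ (abs_nonneg _)
  exact pow_le_pow_left₀ (abs_nonneg u) (by rw [abs_of_nonneg hu.1]; exact hu.2) _

/-- Two-sided enclosure `φ yLo ≤ y_c ≤ φ yHi`. [folklore] -/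
theorem wv_mem_yLo_yHi (j s : ℕ) (h sp : K) {u : ℝ} (hu : u ∈ Set.Icc 0 (φ h))
    {w' : Fin 4 → ℤ → ℝ} (hw : (T.toCertData φ).InBall j w' (φ sp)) {c : ℕ} (hc : c < T.n) :
    φ (T.yLo j (T.node j s) h sp c) ≤ T.wv ((T.toCertData φ).TP j s u + w') c ∧
      T.wv ((T.toCertData φ).TP j s u + w') c ≤ φ (T.yHi j (T.node j s) h sp c) := by
  have hh := T.abs_wv_sub_tp0_le hφ j s h sp hu hw hc
  rw [abs_le] at hh
  unfold yLo yHi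
  simp only [map_sub, map_add]
  rw [map_add] at hh
  constructor <;> linarith [hh.1, hh.2]

/-- `|y_c| ≤ φ yAbs_c`. [folklore] -/
theorem abs_wv_le_yAbs (j s : ℕ) (h sp : K) {u : ℝ} (hu : u ∈ Set.Icc 0 (φ h))
    {w' : Fin 4 → ℤ → ℝ} (hw : (T.toCertData φ).InBall j w' (φ sp)) {c : ℕ} (hc : c < T.n) :
    |T.wv ((T.toCertData φ).TP j s u + w') c| ≤ φ (T.yAbs j (T.node j s) h sp c) := by
  have hh := T.abs_wv_sub_tp0_le hφ j s h sp hu hw hc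
  unfold yAbs
  rw [map_add, map_add, phi_abs hφ]
  rw [map_add] at hh
  have h3 : |T.wv ((T.toCertData φ).TP j s u + w') c| ≤
      |φ (tp0 (T.node j s) c)| + |T.wv ((T.toCertData φ).TP j s u + w') c - φ (tp0 (T.node j s) c)| := by
    have := abs_add_le (φ (tp0 (T.node j s) c)) (T.wv ((T.toCertData φ).TP j s u + w') c - φ (tp0 (T.node j s) c))
    rwa [add_sub_cancel] at this
  linarith

/-- `φ aLo ≤ |y_{i₀,1}|` (reverse triangle inequality). [folklore] -/
theorem aLo_le_abs_wv (j s : ℕ) (h sp : K) {u : ℝ} (hu : u ∈ Set.Icc 0 (φ h))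
    {w' : Fin 4 → ℤ → ℝ} (hw : (T.toCertData φ).InBall j w' (φ sp)) (hc : T.idx T.i₀ 1 < T.n) :
    φ (T.aLo j (T.node j s) h sp) ≤ |T.wv ((T.toCertData φ).TP j s u + w') (T.idx T.i₀ 1)| := by
  have hh := T.abs_wv_sub_tp0_le hφ j s h sp hu hw hc
  unfold aLo
  rw [map_sub, map_sub, phi_abs hφ]
  rw [map_add] at hh
  have h3 := abs_sub_abs_le_abs_sub (φ (tp0 (T.node j s) (T.idx T.i₀ 1)))
    (T.wv ((T.toCertData φ).TP j s u + w') (T.idx T.i₀ 1))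
  rw [abs_sub_comm] at h3
  linarith

end Enclosure

end CertTables

end Summit.NavierStokesRegularity.NavierStokesRegularity.Theorems.TaylorModelCert
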